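import Literature.NumberTheory.EllipticCurves.SelmerCorankProofs
import Literature.NumberTheory.EllipticCurves.BSDSha
import Literature.NumberTheory.EllipticCurves.ShaTorsion
import Literature.NumberTheory.EllipticCurves.ShaFiniteProofs
import Literature.GroupTheory.FiniteAbelian.AlternatingPairing
import Mathlib.Data.Nat.Factorization.Basic
import HarnessLib

/-!
# Cassels–Tate parity: `dim_{𝔽_p} Ш(E/K)[p^∞]/p` is even

Topic `Literature/NumberTheory/EllipticCurves`, family `bsd`. This file proves, from the tree's named
fact `WeierstrassCurve.exists_casselsTate_pairing` (bsd.S18: an alternating bi-additive pairing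
`Ш(E/K) × Ш(E/K) → ℚ/ℤ` whose kernel is the subgroup of divisible elements; Cassels, J. reine angew.
Math. 211 (1962); Tate, Proc. ICM 1962; Milne, *Arithmetic Duality Theorems*, I.6.13(a), I.6.26),
the parity statement consumed by the `p`-Selmer-rank form of the `p`-parity theorem
(`Literature.NumberTheory.EllipticCurves.even_selmerRank_sub_torsionRank_iff`, Bhargava–Shankar's
Thm 42 = Dokchitser–Dokchitser 2010 Thm 1.4 in the form `s_p(E) - t_p(E) ≡ … (mod 2)`):

* `even_finrank_modN_primaryComponent_sha`: for an elliptic curve `E` over a number field `K` and a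
  prime `p`, **`dim_{𝔽_p} (Ш(E/K)[p^∞] ⊗ 𝔽_p)` is even** — the second term of the tree's corank
  formula `zpCorank Ш[p^∞] p = dim Ш[p^∞][p] - dim Ш[p^∞]/p` (`Literature.NumberTheory.EllipticCurves.zpCorank`,
  `WeierstrassCurve.shaCorank`). Classically this is `Ш[p^∞] ≅ (ℚ_p/ℤ_p)^{ρ_p} ⊕ M ⊕ M`; only the
  parity is proved, which is all that `dim Ш[p] ≡ corank Ш[p^∞] (mod 2)` needs.

The group theory is separated from the arithmetic:

* `exists_natCard_modN_eq_pow_two_mul_of_pairing` (**group-theoretic core**): a `p`-primary abelian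
  group `A` with finite `A[p]`, carrying a bi-additive alternating pairing `B : A × A → Q` with
  `Q[p] ↪ 𝔽_p` whose left kernel lies in `⋂_k p^k A`, has `#(A/pA) = p^{2k}`. Proof: the decreasing
  chain `A[p] ∩ p^k A` of subgroups of the finite group `A[p]` stabilises at some `k₀`
  (`exists_torsionBy_inf_range_stable`); then `C = p^{k₀} A` is `p`-divisible
  (`exists_nsmul_eq_of_stable`, induction on the order), so `B` vanishes on `C × A` and `A × C`
  and descends to `T = A/C` (`exists_quotient_pairing`), where it is nondegenerate (the kernel lies
  in `p^{k₀} A = C`); `T` is finite (`T[p]` is the image of `A[p]`, and `p^{k₀} T = 0`), so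
  `#T[p] = p^{2k}` by `Literature.GroupTheory.FiniteAbelian.exists_natCard_torsionBy_eq_pow_two_mul`;
  and `A/pA ≅ T/pT` (`modNEquivOfExact` of `SelmerCorankProofs`, `C` being `p`-divisible),
  `#(T/pT) = #T[p]`.
* `exists_natCard_modN_primaryComponent_sha` (**the arithmetic input**): for `A = Ш(E/K)[p^∞]`,
  `A[p] ⊆ Ш[p]` is finite (`finite_sha_torsionBy_holds`, Silverman X.4.2(b)), `Ш` is torsion
  (`WeierstrassCurve.isTorsion_sha`), so an element of `A` orthogonal to `A` is orthogonal to all of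
  `Ш` (an element killed by `p^e` and by `m` prime to `p` vanishes,
  `eq_zero_of_coprime_nsmul`), hence divisible in `Ш` by the kernel clause of the
  Cassels–Tate fact, hence lies in every `p^k A`; and `(ℚ/ℤ)[p] ≅ ℤ/p`
  (`Literature.GroupTheory.FiniteAbelian.exists_circleTorsion_toZMod_injective`).

No new named facts; the Cassels–Tate pairing enters as the explicit hypothesis
`(hCT : WeierstrassCurve.exists_casselsTate_pairing)`.

## References

* J. W. S. Cassels, *Arithmetic on curves of genus 1. IV. Proof of the Hauptvermutung*, J. reine
  angew. Math. 211 (1962) 95–112.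
* J. Tate, *Duality theorems in Galois cohomology over number fields*, Proc. ICM Stockholm 1962,
  288–295.
* J. S. Milne, *Arithmetic Duality Theorems*, 2nd ed. (2006), I.6.13(a), I.6.26.
* T. Dokchitser, V. Dokchitser, Ann. of Math. 172 (2010) 567–596, Thm 1.4 (the corank form of
  `p`-parity; the Selmer-rank form differs from it exactly by the parity proved here).
-/

noncomputable section

open scoped Classical
open scoped AddSubgroup
open Literature.GroupTheory.FiniteAbelian

namespace Literature.NumberTheory.EllipticCurves

universe u

section Primary

variable {A : Type*} [AddCommGroup A] {Q : Type*} [AddCommGroup Q] (p : ℕ)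

/-- `p^k A ⊆ p^j A` for `j ≤ k`. [folklore] -/
theorem range_nsmul_pow_le {j k : ℕ} (h : j ≤ k) :
    (nsmulAddMonoidHom (α := A) (p ^ k)).range ≤ (nsmulAddMonoidHom (α := A) (p ^ j)).range := by
  rintro _ ⟨a, rfl⟩
  obtain ⟨i, rfl⟩ := Nat.exists_eq_add_of_le h
  exact ⟨p ^ i • a, by rw [nsmulAddMonoidHom_apply, nsmulAddMonoidHom_apply, smul_smul, ← pow_add]⟩

/-- **The chain `A[p] ∩ p^k A` stabilises** when `A[p]` is finite: there is `k₀` with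
`A[p] ∩ p^k A = A[p] ∩ p^{k₀} A` for all `k ≥ k₀` (a decreasing chain of subgroups of a finite
group). [folklore] -/
theorem exists_torsionBy_inf_range_stable [Finite A[(p : ℤ)]] :
    ∃ k₀ : ℕ, ∀ k, k₀ ≤ k →
      A[(p : ℤ)] ⊓ (nsmulAddMonoidHom (α := A) (p ^ k)).range =
        A[(p : ℤ)] ⊓ (nsmulAddMonoidHom (α := A) (p ^ k₀)).range := by
  set S : ℕ → AddSubgroup A := fun k ↦ A[(p : ℤ)] ⊓ (nsmulAddMonoidHom (α := A) (p ^ k)).range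
    with hS
  have hanti : ∀ {j k : ℕ}, j ≤ k → S k ≤ S j := fun h ↦ inf_le_inf_left _ (range_nsmul_pow_le p h)
  haveI hfin : ∀ k, Finite (S k) := fun k ↦
    Finite.of_injective (AddSubgroup.inclusion (inf_le_left : S k ≤ A[(p : ℤ)]))
      (AddSubgroup.inclusion_injective _)
  set f : ℕ → ℕ := fun k ↦ Nat.card (S k) with hf
  obtain ⟨k₁, hk₁⟩ : sInf (Set.range f) ∈ Set.range f := Nat.sInf_mem (Set.range_nonempty f)
  refine ⟨k₁, fun k hk ↦ ?_⟩
  have h1 : S k ≤ S k₁ := hanti hk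
  have hle : f k₁ ≤ f k := hk₁ ▸ Nat.sInf_le ⟨k, rfl⟩
  exact AddSubgroup.eq_of_le_of_card_ge h1 hle

/-- **`C = p^{k₀} A` is `p`-divisible** once the chain `A[p] ∩ p^k A` is stable from `k₀` on: every
`c ∈ C` killed by `p^m` is `p • c'` with `c' ∈ C` (induction on `m`: `p^{m-1} c ∈ A[p] ∩ p^{k₀+m-1} A
= A[p] ∩ p^{k₀+m} A`, so `p^{m-1} c = p^{m-1} (p^{k₀+1} a')`, and `c - p^{k₀+1} a' ∈ C` is killed by
`p^{m-1}`). [folklore] -/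
theorem exists_nsmul_eq_of_stable {k₀ : ℕ}
    (hst : ∀ k, k₀ ≤ k → A[(p : ℤ)] ⊓ (nsmulAddMonoidHom (α := A) (p ^ k)).range =
      A[(p : ℤ)] ⊓ (nsmulAddMonoidHom (α := A) (p ^ k₀)).range) (m : ℕ) :
    ∀ c ∈ (nsmulAddMonoidHom (α := A) (p ^ k₀)).range, p ^ m • c = 0 →
      ∃ c' ∈ (nsmulAddMonoidHom (α := A) (p ^ k₀)).range, p • c' = c := by
  induction m with
  | zero =>
    intro c _ hc
    rw [pow_zero, one_smul] at hc
    exact ⟨0, zero_mem _, by rw [hc, smul_zero]⟩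
  | succ m ih =>
    rintro c ⟨a, rfl⟩ hc
    rw [nsmulAddMonoidHom_apply] at hc ⊢
    -- `d := p^m • c ∈ A[p] ∩ p^(k₀+m) A = A[p] ∩ p^(k₀+m+1) A`
    have hd : p ^ m • (p ^ k₀ • a) ∈
        A[(p : ℤ)] ⊓ (nsmulAddMonoidHom (α := A) (p ^ (k₀ + m + 1))).range := by
      rw [hst (k₀ + m + 1) (by omega), ← hst (k₀ + m) (by omega)]
      refine AddSubgroup.mem_inf.mpr ⟨?_, a, ?_⟩
      · rw [AddSubgroup.torsionBy.nsmul_iff, smul_smul, ← pow_succ', hc]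
      · rw [nsmulAddMonoidHom_apply, smul_smul, ← pow_add, add_comm]
    obtain ⟨-, a', ha'⟩ := AddSubgroup.mem_inf.mp hd
    rw [nsmulAddMonoidHom_apply] at ha'
    -- `c₁ := p^k₀ • (a - p • a') ∈ C` is killed by `p^m`
    have hc₁mem : p ^ k₀ • (a - p • a') ∈ (nsmulAddMonoidHom (α := A) (p ^ k₀)).range :=
      ⟨a - p • a', rfl⟩
    have hc₁ : p ^ m • (p ^ k₀ • (a - p • a')) = 0 := by
      rw [smul_sub, smul_sub, sub_eq_zero, ← ha']
      simp only [smul_smul]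
      congr 1
      ring
    obtain ⟨c₁', hc₁'mem, hc₁'⟩ := ih _ hc₁mem hc₁
    refine ⟨c₁' + p ^ k₀ • a', add_mem hc₁'mem ⟨a', rfl⟩, ?_⟩
    rw [smul_add, hc₁', smul_sub, smul_comm p (p ^ k₀) a', sub_add_cancel]

/-- A bi-additive pairing vanishing on `N` in each variable descends to `A / N`. [folklore] -/
theorem exists_quotient_pairing (N : AddSubgroup A) (B : A →+ A →+ Q)
    (h₁ : ∀ c ∈ N, ∀ b, B c b = 0) (h₂ : ∀ a, ∀ c ∈ N, B a c = 0) :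
    ∃ B' : A ⧸ N →+ A ⧸ N →+ Q,
      ∀ a b, B' (QuotientAddGroup.mk a) (QuotientAddGroup.mk b) = B a b := by
  let L : A →+ (A ⧸ N →+ Q) :=
    { toFun := fun a ↦ QuotientAddGroup.lift N (B a) (fun c hc ↦ by
        rw [AddMonoidHom.mem_ker]; exact h₂ a c hc)
      map_zero' := QuotientAddGroup.addMonoidHom_ext _ (by
        ext b
        change B 0 b = 0
        rw [map_zero, AddMonoidHom.zero_apply])
      map_add' := fun a a' ↦ QuotientAddGroup.addMonoidHom_ext _ (by
        ext b
        change B (a + a') b = B a b + B a' b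
        rw [map_add, AddMonoidHom.add_apply]) }
  have hL : N ≤ L.ker := by
    intro c hc
    rw [AddMonoidHom.mem_ker]
    refine QuotientAddGroup.addMonoidHom_ext _ ?_
    ext b
    exact h₁ c hc b
  exact ⟨QuotientAddGroup.lift N L hL, fun _ _ ↦ rfl⟩

/-- Two commuting annihilators: if `a • x = 0` and `b • x = 0` with `a`, `b` coprime naturals, then
`x = 0` (local copy of the helper of the same content in `KramerShaIsogeny`, not imported here).
[folklore] -/
private theorem eq_zero_of_coprime_nsmul {x : Q} {a b : ℕ} (hab : a.Coprime b)
    (ha : a • x = 0) (hb : b • x = 0) : x = 0 := by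
  rw [← addOrderOf_dvd_iff_nsmul_eq_zero] at ha hb
  exact AddMonoid.addOrderOf_eq_one_iff.mp (Nat.eq_one_of_dvd_coprimes hab ha hb)

variable [hp : Fact p.Prime]

/-- **Cassels–Tate parity, group-theoretic core.** Let `A` be a `p`-primary abelian group with
finite `p`-torsion, carrying a bi-additive alternating pairing `B : A × A → Q` whose `p`-torsion
values embed in `𝔽_p` (`ι`) and whose left kernel consists of `p^∞`-divisible elements (`hker`:
`B(a, ·) = 0 ⇒ a ∈ p^k A` for all `k`). Then `#(A/pA) = p^{2k}`, i.e. `dim_{𝔽_p} A/pA` is even.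
Proof: the chain `A[p] ∩ p^k A` stabilises at some `k₀` (`exists_torsionBy_inf_range_stable`),
whence `C = p^{k₀} A` is `p`-divisible (`exists_nsmul_eq_of_stable`), hence in the kernel of `B`;
`T = A/C` is finite (`T[p]` is the image of `A[p]`, and `p^{k₀} T = 0`) and inherits a nondegenerate
alternating pairing, so `#T[p] = p^{2k}`
(`Literature.GroupTheory.FiniteAbelian.exists_natCard_torsionBy_eq_pow_two_mul`); finally
`A/pA ≅ T/pT` (`modNEquivOfExact`, `C` being `p`-divisible) and `#T/pT = #T[p]`. This is the
elementary shadow of `A ≅ (ℚ_p/ℤ_p)^ρ ⊕ M ⊕ M`. [folklore] -/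
theorem exists_natCard_modN_eq_pow_two_mul_of_pairing (hA : ∀ a : A, ∃ n : ℕ, p ^ n • a = 0)
    [Finite A[(p : ℤ)]] (B : A →+ A →+ Q) (halt : ∀ a, B a a = 0)
    (hker : ∀ a, (∀ b, B a b = 0) → ∀ k : ℕ, a ∈ (nsmulAddMonoidHom (α := A) (p ^ k)).range)
    (ι : Q[(p : ℤ)] →+ ZMod p) (hι : Function.Injective ι) :
    ∃ k : ℕ, Nat.card (ModN A p) = p ^ (2 * k) := by
  obtain ⟨k₀, hst⟩ := exists_torsionBy_inf_range_stable (A := A) p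
  set C : AddSubgroup A := (nsmulAddMonoidHom (α := A) (p ^ k₀)).range with hC
  -- `C` is `p`-divisible, hence `p^j`-divisible
  have hdiv : ∀ c ∈ C, ∃ c' ∈ C, p • c' = c := fun c hc ↦ by
    obtain ⟨n, hn⟩ := hA c
    exact exists_nsmul_eq_of_stable p hst n c hc hn
  have hdiv' : ∀ (j : ℕ), ∀ c ∈ C, ∃ c' ∈ C, p ^ j • c' = c := by
    intro j
    induction j with
    | zero => exact fun c hc ↦ ⟨c, hc, by rw [pow_zero, one_smul]⟩
    | succ j ih =>
      intro c hc
      obtain ⟨c₁, hc₁, rfl⟩ := ih c hc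
      obtain ⟨c₂, hc₂, rfl⟩ := hdiv c₁ hc₁
      exact ⟨c₂, hc₂, by rw [pow_succ, ← smul_smul]⟩
  -- `B` vanishes on `C × A` and `A × C`
  have hC₁ : ∀ c ∈ C, ∀ b, B c b = 0 := by
    intro c hc b
    obtain ⟨n, hn⟩ := hA b
    obtain ⟨c', -, rfl⟩ := hdiv' n c hc
    rw [map_nsmul, AddMonoidHom.nsmul_apply, ← map_nsmul, hn, map_zero]
  have hC₂ : ∀ a, ∀ c ∈ C, B a c = 0 := fun a c hc ↦ by
    rw [eq_neg_of_alternating B halt, hC₁ c hc a, neg_zero]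
  -- the quotient `T = A / C` and its pairing
  obtain ⟨B', hB'⟩ := exists_quotient_pairing C B hC₁ hC₂
  have hB'alt : ∀ z, B' z z = 0 := by
    intro z
    induction z using QuotientAddGroup.induction_on with
    | H a => rw [hB', halt]
  have hB'nd : ∀ z, (∀ w, B' z w = 0) → z = 0 := by
    intro z hz
    induction z using QuotientAddGroup.induction_on with
    | H a =>
      rw [QuotientAddGroup.eq_zero_iff, hC]
      exact hker a (fun b ↦ by rw [← hB', hz]) k₀
  -- `T[p]` is the image of `A[p]`
  haveI : Finite (A ⧸ C)[(p : ℤ)] := by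
    refine Finite.of_surjective (fun x : A[(p : ℤ)] ↦ (⟨QuotientAddGroup.mk (x : A), ?_⟩ :
      (A ⧸ C)[(p : ℤ)])) ?_
    · rw [AddSubgroup.torsionBy.nsmul_iff, ← QuotientAddGroup.mk_nsmul,
        AddSubgroup.torsionBy.nsmul_iff.mp x.2, QuotientAddGroup.mk_zero]
    · rintro ⟨z, hz⟩
      induction z using QuotientAddGroup.induction_on with
      | H a =>
        rw [AddSubgroup.torsionBy.nsmul_iff, ← QuotientAddGroup.mk_nsmul,
          QuotientAddGroup.eq_zero_iff] at hz
        obtain ⟨c, hc, hca⟩ := hdiv _ hz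
        refine ⟨⟨a - c, ?_⟩, Subtype.ext ?_⟩
        · rw [AddSubgroup.torsionBy.nsmul_iff, smul_sub, hca, sub_self]
        · change (QuotientAddGroup.mk (a - c) : A ⧸ C) = QuotientAddGroup.mk a
          rw [QuotientAddGroup.mk_sub, (QuotientAddGroup.eq_zero_iff c).mpr hc, sub_zero]
  -- `p^k₀ T = 0`, so `T` is finite
  haveI : Finite (A ⧸ C) := by
    haveI := finite_torsionBy_pow (A ⧸ C) p k₀
    refine Finite.of_injective (fun z : A ⧸ C ↦ (⟨z, ?_⟩ : (A ⧸ C)[((p ^ k₀ : ℕ) : ℤ)]))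
      (fun z w h ↦ congrArg Subtype.val h)
    induction z using QuotientAddGroup.induction_on with
    | H a =>
      rw [AddSubgroup.torsionBy.nsmul_iff, ← QuotientAddGroup.mk_nsmul, QuotientAddGroup.eq_zero_iff]
      exact ⟨a, rfl⟩
  -- even `p`-rank of `T`, and `A/pA ≅ T/pT`, `#T/pT = #T[p]`
  obtain ⟨k, hk⟩ := exists_natCard_torsionBy_eq_pow_two_mul p ι hι (A ⧸ C) B' hB'alt hB'nd
  refine ⟨k, ?_⟩
  have e : ModN A p ≃+ ModN (A ⧸ C) p :=
    modNEquivOfExact (i := C.subtype) (f := QuotientAddGroup.mk' C) (QuotientAddGroup.mk'_surjective C)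
      (fun a ha ↦ by rw [AddSubgroup.range_subtype]; exact (QuotientAddGroup.eq_zero_iff a).mp ha)
      (fun d ↦ by
        obtain ⟨d', hd', h⟩ := hdiv d d.2
        exact ⟨⟨d', hd'⟩, Subtype.ext h⟩)
  rw [Nat.card_congr e.toEquiv, ← natCard_torsionBy_eq_natCard_modN, hk]

end Primary

/-! ### `Ш(E/K)[p^∞]` -/

section Sha

open WeierstrassCurve

variable {K : Type u} [Field K] [NumberField K] (W : WeierstrassCurve K) [W.IsElliptic]
  (p : ℕ) [hp : Fact p.Prime]

/-- **`dim_{𝔽_p} Ш(E/K)[p^∞] ⊗ 𝔽_p` is even (Cassels–Tate).** Granting the Cassels–Tate pairing on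
`Ш(E/K)` — alternating, with kernel the divisible elements (`hCT`, the tree's named fact
`WeierstrassCurve.exists_casselsTate_pairing`: Cassels 1962; Tate 1963; Milne, *ADT*, I.6.13(a),
I.6.26) — the `p`-primary part `A = Ш(E/K)[p^∞]` satisfies `#(A/pA) = p^{2k}`: `A[p] ⊆ Ш[p]` is
finite (`finite_sha_torsionBy_holds`, Silverman X.4.2), `Ш` is torsion (`isTorsion_sha`), so an
element of `A` orthogonal to `A` is orthogonal to all of `Ш` (coprime-order argument), hence
divisible in `Ш`, hence in every `p^k A`; now apply `exists_natCard_modN_eq_pow_two_mul_of_pairing`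
with `(ℚ/ℤ)[p] ≅ ℤ/p`. Classically: `Ш[p^∞] ≅ (ℚ_p/ℤ_p)^{ρ_p} ⊕ M ⊕ M`. [folklore] -/
theorem exists_natCard_modN_primaryComponent_sha (hCT : exists_casselsTate_pairing (K := K)) :
    ∃ k : ℕ, Nat.card (ModN ↥(AddCommGroup.primaryComponent W.sha p) p) = p ^ (2 * k) := by
  obtain ⟨B, halt, hkerB⟩ := hCT W
  set A : AddSubgroup W.sha := AddCommGroup.primaryComponent W.sha p with hAdef
  -- `A` is `p`-primary with finite `p`-torsion
  have hA : ∀ a : A, ∃ n : ℕ, p ^ n • a = 0 := fun a ↦ by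
    obtain ⟨n, hn⟩ := (AddCommGroup.mem_primaryComponent).mp a.2
    exact ⟨n, Subtype.ext hn⟩
  haveI : Finite (AddSubgroup.torsionBy W.sha (p : ℤ)) :=
    W.finite_sha_torsionBy_holds p (Int.natCast_ne_zero.mpr hp.out.ne_zero)
  haveI : Finite (↥A)[(p : ℤ)] :=
    Finite.of_injective
      (fun x ↦ (⟨((x : A) : W.sha), AddSubgroup.torsionBy.nsmul_iff.mpr (by
          rw [← AddSubgroupClass.coe_nsmul, ← AddSubgroupClass.coe_nsmul, AddSubgroup.torsionBy.nsmul x,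
            ZeroMemClass.coe_zero, ZeroMemClass.coe_zero])⟩ :
          AddSubgroup.torsionBy W.sha p))
      (fun x y hxy ↦ Subtype.ext (Subtype.ext (congrArg (fun z : AddSubgroup.torsionBy W.sha p ↦
        (z : W.sha)) hxy)))
  -- the pairing restricted to `A`
  let BA : A →+ A →+ AddCircle (1 : ℚ) := (AddMonoidHom.compHom' A.subtype).comp (B.comp A.subtype)
  have hBA : ∀ a b : A, BA a b = B a b := fun _ _ ↦ rfl
  have hBAalt : ∀ a : A, BA a a = 0 := fun a ↦ by rw [hBA, halt]
  -- its kernel is `p^∞`-divisible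
  have hker : ∀ a : A, (∀ b : A, BA a b = 0) →
      ∀ k : ℕ, a ∈ (nsmulAddMonoidHom (α := A) (p ^ k)).range := by
    intro a ha k
    obtain ⟨e, he⟩ := hA a
    -- `a` is orthogonal to all of `Ш`
    have hall : ∀ z : W.sha, B a z = 0 := by
      intro z
      have hz := W.isTorsion_sha z
      set n := addOrderOf z with hn
      have hn0 : n ≠ 0 := (hz.addOrderOf_pos).ne'
      obtain ⟨v, m, hm, hnm⟩ := Nat.exists_eq_pow_mul_and_not_dvd hn0 p hp.out.ne_one
      -- `m • z ∈ A`
      have hmz : m • z ∈ A := by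
        rw [hAdef, AddCommGroup.mem_primaryComponent]
        refine ⟨v, ?_⟩
        rw [smul_smul, ← hnm, hn, addOrderOf_nsmul_eq_zero]
      have h1 : m • B a z = 0 := by
        rw [← map_nsmul]
        have h := ha ⟨m • z, hmz⟩
        rwa [hBA] at h
      have h2 : p ^ e • B a z = 0 := by
        rw [← AddMonoidHom.nsmul_apply, ← map_nsmul]
        have : (p ^ e • a : A) = 0 := he
        rw [← AddSubgroupClass.coe_nsmul, this, ZeroMemClass.coe_zero, map_zero, AddMonoidHom.zero_apply]
      exact eq_zero_of_coprime_nsmul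
        (Nat.Coprime.pow_left e ((Nat.Prime.coprime_iff_not_dvd hp.out).mpr hm)) h2 h1
    -- hence divisible in `Ш`, hence in `p^k A`
    have hdivz : ((a : A) : W.sha) ∈ AddSubgroup.divisibleElements W.sha := (hkerB _).mp hall
    obtain ⟨y, hy⟩ := (AddSubgroup.mem_divisibleElements_iff _ _).mp hdivz (p ^ k) (pow_pos hp.out.pos k)
    have hyA : y ∈ A := by
      rw [hAdef, AddCommGroup.mem_primaryComponent]
      refine ⟨k + e, ?_⟩
      rw [pow_add, mul_comm, ← smul_smul, hy, ← AddSubgroupClass.coe_nsmul]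
      have : (p ^ e • a : A) = 0 := he
      rw [this, ZeroMemClass.coe_zero]
    exact ⟨⟨y, hyA⟩, Subtype.ext (by rw [nsmulAddMonoidHom_apply, AddSubgroupClass.coe_nsmul]; exact hy)⟩
  obtain ⟨ι, hι⟩ := exists_circleTorsion_toZMod_injective p
  exact exists_natCard_modN_eq_pow_two_mul_of_pairing p hA BA hBAalt hker ι hι

/-- **Corollary (finrank form)**: granting the Cassels–Tate pairing,
`dim_{𝔽_p} (Ш(E/K)[p^∞] / p Ш(E/K)[p^∞])` — the second term of the corank formula
`Literature.NumberTheory.EllipticCurves.zpCorank` for `Ш[p^∞]` — is even. [folklore] -/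
theorem even_finrank_modN_primaryComponent_sha (hCT : exists_casselsTate_pairing (K := K)) :
    Even (Module.finrank (ZMod p) (ModN ↥(AddCommGroup.primaryComponent W.sha p) p)) := by
  obtain ⟨k, hk⟩ := exists_natCard_modN_primaryComponent_sha W p hCT
  haveI : Finite (ModN ↥(AddCommGroup.primaryComponent W.sha p) p) :=
    Nat.finite_of_card_ne_zero (by rw [hk]; exact pow_ne_zero _ hp.out.ne_zero)
  refine ⟨k, Nat.pow_right_injective hp.out.two_le ?_⟩
  simp only [pow_finrank_eq_natCard, hk, two_mul]

end Sha

end Literature.NumberTheory.EllipticCurves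

end
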